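import Summits.AtomisticToContinuum.BoseEinsteinCondensation.Theses.BECModePrice
import Literature.MathematicalPhysics.QuantumManyBody.PeriodicBoseGasFracEnergy
import Literature.MathematicalPhysics.QuantumManyBody.BoseGasDirichletWall
import Literature.Barriers.AtomisticToContinuum.KineticGapLengthScalesNarrow
import Summits.AtomisticToContinuum.BoseEinsteinCondensation.Theorems.PuffFloor.Negative.CorePairDominationConstState
import HarnessLib

/-!
# The softening coefficient of `ModePriceIntegrable` is load-bearing exactly at `1` (free gas)
(negative-side lemma for crux `ModePriceIntegrable`, stmt-AtomisticToContinuum-18512, route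
BECModePrice; cdisprove seat, cycle 1, 2026-08-17)

The crux `BECModePrice.ModePriceIntegrable` asserts, for every repulsive finite-range integrable
`v`, constants `C, ρ₀ > 0` with, for `0 < ρ < ρ₀`, eventually in `N`, for every mode `p ≠ 0` and
every periodic trial state `Ψ` on the torus of side `L = (N/ρ)^{1/3}`,
`E₀^per + ½|2πp/L|² n_p(Ψ) ≤ ⟨Ψ,HΨ⟩ + Cρ`. Here the softening coefficient `½` is made a parameter
(`ModePriceWithCoeff c`; the crux is `c = 2⁻¹` DEFINITIONALLY, `modePriceIntegrable_iff_coeff_half`)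
and the FREE gas `v ≡ 0` — a legal member of the class — is evaluated exactly:

* `modePriceBody_zero_pot_of_le_one` — for `v ≡ 0` (constant state `constState` of
  `PuffFloor/Negative/CorePairDominationConstState`, `E₀^per(0) = 0` of `BoseGasDirichletWall`) the body holds with EVERY coefficient `c ≤ 1`,
  zero budget, every `N ≥ 1`, every box: `E₀^per(0) = 0` and `c|k|²n_p ≤ |k|²n_p ≤ ∫|∇Ψ|²` (one term
  of the Parseval identity `tsum_fracDispersion_two_mul_cellOccupation`). The free gas is no witness
  against the crux (`modePriceIntegrable_zero_pot`), nor against any `c ≤ 1`.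
* `not_modePriceBody_zero_pot_of_one_lt`, `modePriceWithCoeff_false_of_one_lt` — for EVERY `c > 1`
  (`c = ⊤` included) the statement is FALSE, already at `v ≡ 0`: the Galilei boost
  `e^{2πi m·∑ⱼxⱼ/L}(L³)^{-N/2}` of the constant state by `m = ±j e₁` has `n_m = N`
  (`cellOccupation_planeWaveMode_boost`: boosts shift occupations, `n_m(Ψ_m) = n₀(Φ)`;
  `condensateOccupation_constState`) and energy `≤ N|k|²` (`exists_boost_energy_le` of
  `KineticGapLengthScalesNarrow`), so the body would force `(c-1)N|k|² ≤ Cρ`, false as `j → ∞`.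

So any proof of the crux must use `2⁻¹ ≤ 1` (`coefficient_threshold_free_gas`): the interacting
content of the crux is entirely the subtraction of `E₀^per`. Riding along: `p ≠ 0` is decoration
(`modePriceBody_zero_mode`); only states with `⟨Ψ,HΨ⟩ < 2E₀^per` matter (`modePrice_of_twice_le`).
No Theses statement is asserted positively. All `[folklore]`.
-/

noncomputable section

open MeasureTheory Filter
open scoped ENNReal NNReal ComplexConjugate

namespace Summit.AtomisticToContinuum.BoseEinsteinCondensation.Theorems.ModePriceIntegrable.Negative

open Literature.MathematicalPhysics.QuantumManyBody.BoseGas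
open Literature.Barriers.AtomisticToContinuum.BoseGas
open Summit.AtomisticToContinuum.BoseEinsteinCondensation.Theses.BECModePrice
open Summit.AtomisticToContinuum.BoseEinsteinCondensation.Theorems.PuffFloor.Negative
  (constAmp constState constState_apply kineticDensity_const periodicEnergy_constState)

variable {N : ℕ} {L : ℝ}

/-! ## §0 The crux with the softening coefficient as a parameter -/

/-- The body of the crux for one potential `v`, constants `C, ρ` and particle number `N`, with the
softening coefficient `c` in place of `2⁻¹`:
`∀ p ≠ 0, ∀ Ψ, E₀^per + c|2πp/L|² n_p(Ψ) ≤ ⟨Ψ,HΨ⟩ + Cρ`, `L = (N/ρ)^{1/3}`. [folklore] -/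
def ModePriceBody (c : ℝ≥0∞) (v : ℝ → ℝ≥0∞) (C ρ : ℝ) (N : ℕ) : Prop :=
  ∀ p : Fin 3 → ℤ, p ≠ 0 → ∀ Ψ : PeriodicTrialState N (sideLength ρ N),
    periodicGroundStateEnergy v N (sideLength ρ N) +
        c * fracDispersion 2 (sideLength ρ N) p *
          cellOccupation N (sideLength ρ N) (planeWaveMode (sideLength ρ N) p) Ψ.ψ ≤
      periodicEnergy v Ψ + ENNReal.ofReal (C * ρ)

/-- The crux with softening coefficient `c` (the crux is `c = 2⁻¹`). [folklore] -/
def ModePriceWithCoeff (c : ℝ≥0∞) : Prop :=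
  ∀ v : ℝ → ℝ≥0∞, IsRepulsiveFiniteRange v → (∫⁻ x : Space, v ‖x‖) ≠ ⊤ →
    ∃ C : ℝ, 0 < C ∧ ∃ ρ₀ : ℝ, 0 < ρ₀ ∧ ∀ ρ : ℝ, 0 < ρ → ρ < ρ₀ →
      ∀ᶠ N : ℕ in atTop, ModePriceBody c v C ρ N

/-- READING: the route decl is `ModePriceWithCoeff 2⁻¹`, definitionally. [folklore] -/
theorem modePriceIntegrable_iff_coeff_half : ModePriceIntegrable ↔ ModePriceWithCoeff 2⁻¹ := Iff.rfl

/-! ## Tools: the constant state (reused from `PuffFloor/Negative`), one Parseval term, boosts shift occupations -/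

/-- The free energy of the constant state is `0`. [folklore] -/
theorem periodicEnergy_constState_zero_pot (hL : 0 < L) :
    periodicEnergy (0 : ℝ → ℝ≥0∞) (constState N hL) = 0 := by
  rw [periodicEnergy_constState]
  simp only [periodicInteraction_zeroPotential, lintegral_zero, zero_mul]

/-- `|2πp/L|² ≠ 0` for `p ≠ 0`, `L ≠ 0`. [folklore] -/
theorem fracDispersion_two_ne_zero (hL : L ≠ 0) {p : Fin 3 → ℤ} (hp : p ≠ 0) :
    fracDispersion 2 L p ≠ 0 := by
  obtain ⟨k, hk⟩ : ∃ k, p k ≠ 0 := Function.ne_iff.1 hp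
  have hk' : (0 : ℝ) < ((p k : ℤ) : ℝ) ^ 2 := by
    have : ((p k : ℤ) : ℝ) ≠ 0 := by exact_mod_cast hk
    positivity
  have hsum : (0 : ℝ) < ∑ j : Fin 3, ((p j : ℤ) : ℝ) ^ 2 :=
    lt_of_lt_of_le hk' (Finset.single_le_sum (f := fun j => ((p j : ℤ) : ℝ) ^ 2)
      (fun j _ => sq_nonneg _) (Finset.mem_univ k))
  have hL2 : (0 : ℝ) < L ^ 2 := lt_of_le_of_ne (sq_nonneg L) (Ne.symm (pow_ne_zero 2 hL))
  rw [fracDispersion_two, ne_eq, ENNReal.ofReal_eq_zero, not_le]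
  exact div_pos (mul_pos (by positivity) hsum) hL2

/-- **One term of Parseval** (kinetic Markov bound, any `v`): `|2πp/L|² n_p(Ψ) ≤ ⟨Ψ,HΨ⟩`.
[folklore] -/
theorem fracDispersion_mul_cellOccupation_le (hL : 0 < L) (v : ℝ → ℝ≥0∞)
    (Ψ : PeriodicTrialState N L) (p : Fin 3 → ℤ) :
    fracDispersion 2 L p * cellOccupation N L (planeWaveMode L p) Ψ.ψ ≤ periodicEnergy v Ψ :=
  calc fracDispersion 2 L p * cellOccupation N L (planeWaveMode L p) Ψ.ψ
      ≤ ∑' q : Fin 3 → ℤ, fracDispersion 2 L q * cellOccupation N L (planeWaveMode L q) Ψ.ψ :=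
        ENNReal.le_tsum p
    _ = ∫⁻ X in cellN N L, kineticDensity Ψ.ψ X := tsum_fracDispersion_two_mul_cellOccupation hL Ψ
    _ ≤ periodicEnergy v Ψ := lintegral_mono fun _ => le_self_add

/-- The constant state has no particle in any mode `p ≠ 0` (Parseval for the gradient: every term
`|k_p|² n_p` of a vanishing sum vanishes). [folklore] -/
theorem cellOccupation_constState_eq_zero (hL : 0 < L) {p : Fin 3 → ℤ} (hp : p ≠ 0) :
    cellOccupation N L (planeWaveMode L p) (constState N hL).ψ = 0 := by
  have h := tsum_fracDispersion_two_mul_cellOccupation hL (constState N hL)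
  have h0 : ∫⁻ X in cellN N L, kineticDensity (constState N hL).ψ X = 0 :=
    (lintegral_congr fun X => kineticDensity_const _ X).trans lintegral_zero
  rw [h0, ENNReal.tsum_eq_zero] at h
  exact (mul_eq_zero.1 (h p)).resolve_left (fracDispersion_two_ne_zero hL.ne' hp)

/-- The constant state is completely condensed: `⟨n₀⟩ = N` (Parseval `∑_p n_p = N` with all
`p ≠ 0` terms zero). [folklore] -/
theorem condensateOccupation_constState (hL : 0 < L) :
    condensateOccupation N L (constState N hL).ψ = N := by
  rw [← cellOccupation_planeWaveMode_zero, ← (constState N hL).tsum_cellOccupation_planeWaveMode hL]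
  exact (tsum_eq_single (0 : Fin 3 → ℤ) fun p hp => cellOccupation_constState_eq_zero hL hp).symm

/-- `∑ⱼ (x, Y)ⱼ = x + ∑ᵢ Yᵢ`. [folklore] -/
theorem configSum_vecCons {n : ℕ} (x : Space) (Y : Config n) :
    configSum (n + 1) (Matrix.vecCons x Y) = x + configSum n Y := by simp [Fin.sum_univ_succ]

/-- `‖e_m(x)‖₊ = 1`. [folklore] -/
theorem nnnorm_cellWave (L : ℝ) (m : Fin 3 → ℤ) (x : Space) : ‖cellWave L m x‖₊ = 1 := by
  rw [← NNReal.coe_inj, coe_nnnorm, norm_cellWave, NNReal.coe_one]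

/-- The slice inner products of a boosted state with the boosted mode are, up to a phase, the
slice means of the original state: `⟨φ_m, Ψ_m(·,Y)⟩ = e_m(∑Y) ⟨φ_0, Φ(·,Y)⟩`. [folklore] -/
theorem integral_conj_planeWaveMode_boost {n : ℕ} (hL : 0 < L) (m : Fin 3 → ℤ)
    (Φ : PeriodicTrialState (n + 1) L) (Y : Config n) :
    ∫ x in cell L, conj (planeWaveMode L m x) * (Φ.boost hL m).ψ (Matrix.vecCons x Y) =
      cellWave L m (configSum n Y) *
        ∫ x in cell L, conj (planeWaveMode L 0 x) * Φ.ψ (Matrix.vecCons x Y) := by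
  rw [← integral_const_mul]
  congr 1
  funext x
  rw [boost_apply, planeWaveMode_eq L m x, planeWaveMode_zero L x, map_mul]
  unfold boostPhase
  rw [configSum_vecCons, cellWave_add]
  have hc : conj (((Real.sqrt (L ^ 3))⁻¹ : ℂ)) = ((Real.sqrt (L ^ 3))⁻¹ : ℂ) := by
    rw [map_inv₀, Complex.conj_ofReal]
  have hce : conj (cellWave L m x) * cellWave L m x = 1 := by
    rw [conj_cellWave, ← cellWave_add_index, neg_add_cancel, cellWave_zero]
  rw [hc]
  linear_combination (((Real.sqrt (L ^ 3))⁻¹ : ℂ) * cellWave L m (configSum n Y) *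
    Φ.ψ (Matrix.vecCons x Y)) * hce

/-- **Boosts shift occupations**: the occupation of the mode `φ_m` in the Galilei boost
`Ψ_m = e^{2πi m·∑ⱼxⱼ/L}Φ` is the constant-mode occupation of `Φ`. [folklore] -/
theorem cellOccupation_planeWaveMode_boost (hL : 0 < L) (m : Fin 3 → ℤ)
    (Φ : PeriodicTrialState N L) :
    cellOccupation N L (planeWaveMode L m) (Φ.boost hL m).ψ = condensateOccupation N L Φ.ψ := by
  cases N with
  | zero => simp [cellOccupation, condensateOccupation, occupation]
  | succ n =>
    rw [← cellOccupation_planeWaveMode_zero, cellOccupation_succ, cellOccupation_succ]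
    congr 1
    refine lintegral_congr fun Y => ?_
    rw [integral_conj_planeWaveMode_boost hL m Φ Y, nnnorm_mul, nnnorm_cellWave, one_mul]

/-- `|2πm/L|² = ∑ₖ (2πm_k/L)²`: the crux's symbol is the barrier file's `boostGap`. [folklore] -/
theorem fracDispersion_two_eq_boostGap (L : ℝ) (m : Fin 3 → ℤ) :
    fracDispersion 2 L m = ENNReal.ofReal (boostGap L m) := by
  rw [fracDispersion_two]
  congr 1
  unfold boostGap
  rw [Finset.mul_sum, Finset.sum_div]
  refine Finset.sum_congr rfl fun k _ => ?_
  ring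

/-- `|−k|² = |k|²`. [folklore] -/
theorem boostGap_neg (L : ℝ) (m : Fin 3 → ℤ) : boostGap L (-m) = boostGap L m := by
  refine Finset.sum_congr rfl fun k _ => ?_
  simp only [Pi.neg_apply, Int.cast_neg]
  ring

/-! ## §1 Load-bearing analysis: the softening coefficient, at the free gas -/

/-- **Free gas, coefficient `≤ 1`: the body holds with zero price** (for every `C`, every `ρ > 0`,
every `N ≥ 1`, every mode): `E₀ = 0` and `c|k|²n_p ≤ |k|²n_p ≤ ∫|∇Ψ|² = ⟨Ψ,HΨ⟩`. So the free gas
is NOT a witness against the crux or against any coefficient up to `1`. [folklore] -/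
theorem modePriceBody_zero_pot_of_le_one {c : ℝ≥0∞} (hc : c ≤ 1) {ρ : ℝ} (hρ : 0 < ρ) (C : ℝ)
    (hN : 0 < N) : ModePriceBody c 0 C ρ N := by
  intro p _ Ψ
  have hL := sideLength_pos_of_pos hρ hN
  rw [periodicGroundStateEnergy_zero_eq_zero N hL, zero_add]
  calc c * fracDispersion 2 _ p * cellOccupation N _ (planeWaveMode _ p) Ψ.ψ
      ≤ 1 * (fracDispersion 2 _ p * cellOccupation N _ (planeWaveMode _ p) Ψ.ψ) := by
        rw [mul_assoc]; exact mul_le_mul_of_nonneg_right hc bot_le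
    _ ≤ periodicEnergy 0 Ψ := by
        rw [one_mul]; exact fracDispersion_mul_cellOccupation_le hL 0 Ψ p
    _ ≤ periodicEnergy 0 Ψ + ENNReal.ofReal (C * ρ) := le_self_add

/-- **Free gas, coefficient `> 1`: the body FAILS** in every box (`ρ > 0`, `N ≥ 1`, any budget
`Cρ`). Witness: the boost `Ψ = e^{2πi m·∑ⱼxⱼ/L}·(L³)^{-N/2}` by `m = ±j e₁` with `j` large — it has
`n_m(Ψ) = N`, `⟨Ψ,HΨ⟩ ≤ N|k|²`, so the body would give `c N|k|² ≤ N|k|² + Cρ`, false once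
`(c-1)N|k|² > Cρ` (`c = ⊤` included). [folklore] -/
theorem not_modePriceBody_zero_pot_of_one_lt {c : ℝ≥0∞} (hc : 1 < c) {ρ : ℝ} (hρ : 0 < ρ) (C : ℝ)
    (hN : 0 < N) : ¬ ModePriceBody c 0 C ρ N := by
  intro h
  have hL := sideLength_pos_of_pos hρ hN
  set L := sideLength ρ N with hLdef
  have hNr : (0 : ℝ) < N := Nat.cast_pos.2 hN
  -- constants: the budget `M` and the slope `K`
  set M : ℝ := max (C * ρ) 0 with hM
  have hM0 : 0 ≤ M := le_max_right _ _
  set K : ℝ := if c = ⊤ then 1 else (c.toReal - 1) * N with hK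
  have hK0 : 0 < K := by
    rw [hK]
    split_ifs with hct
    · exact one_pos
    · have h1 : (1 : ℝ≥0∞).toReal < c.toReal := (ENNReal.toReal_lt_toReal ENNReal.one_ne_top hct).2 hc
      rw [ENNReal.toReal_one] at h1
      exact mul_pos (by linarith) hNr
  -- a large axis momentum `j' e₁`
  obtain ⟨j, hj⟩ := exists_nat_gt (M * L ^ 2 / (4 * Real.pi ^ 2 * K))
  have hj1 : (1 : ℝ) ≤ (j + 1 : ℕ) := by exact_mod_cast Nat.succ_le_succ (Nat.zero_le j)
  have hj' : M * L ^ 2 / (4 * Real.pi ^ 2 * K) < (j + 1 : ℕ) :=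
    hj.trans (by exact_mod_cast Nat.lt_succ_self j)
  set p : Fin 3 → ℤ := axisMode ((j + 1 : ℕ) : ℤ) with hp
  have hp0 : p ≠ 0 := by
    intro h0
    have := congr_fun h0 0
    rw [hp, axisMode_apply_zero, Pi.zero_apply] at this
    exact Nat.succ_ne_zero j (by exact_mod_cast this)
  set d : ℝ := boostGap L p with hd
  have hd' : d = 4 * Real.pi ^ 2 * ((j + 1 : ℕ) : ℝ) ^ 2 / L ^ 2 := by
    rw [hd, hp, boostGap_axisMode]
    push_cast
    ring
  have hdpos : 0 < d := by rw [hd']; positivity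
  have hdK : M < d * K := by
    have hπ : (0 : ℝ) < 4 * Real.pi ^ 2 * K := by positivity
    have hL2 : (0 : ℝ) < L ^ 2 := by positivity
    have h1 : M * L ^ 2 < (j + 1 : ℕ) * (4 * Real.pi ^ 2 * K) := (div_lt_iff₀ hπ).1 hj'
    have h2 : ((j + 1 : ℕ) : ℝ) ≤ ((j + 1 : ℕ) : ℝ) ^ 2 := by nlinarith
    have h3 : M * L ^ 2 < ((j + 1 : ℕ) : ℝ) ^ 2 * (4 * Real.pi ^ 2 * K) :=
      h1.trans_le (mul_le_mul_of_nonneg_right h2 hπ.le)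
    rw [hd', div_mul_eq_mul_div, lt_div_iff₀ hL2]
    nlinarith [h3]
  -- the witness: a boost of the constant state
  set Φ := constState N hL with hΦ
  obtain ⟨m', hm', hE⟩ := exists_boost_energy_le hL 0 p Φ
  have hm'0 : m' ≠ 0 := by
    rcases hm' with rfl | rfl
    · exact hp0
    · exact neg_ne_zero.2 hp0
  have hgap : fracDispersion 2 L m' = ENNReal.ofReal d := by
    rcases hm' with rfl | rfl
    · exact fracDispersion_two_eq_boostGap L p
    · rw [fracDispersion_two_eq_boostGap, boostGap_neg]
  have hocc : cellOccupation N L (planeWaveMode L m') (Φ.boost hL m').ψ = N := by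
    rw [cellOccupation_planeWaveMode_boost, hΦ, condensateOccupation_constState]
  have key := h m' hm'0 (Φ.boost hL m')
  rw [periodicGroundStateEnergy_zero_eq_zero N hL, zero_add, hgap, hocc] at key
  rw [hΦ, periodicEnergy_constState_zero_pot hL, zero_add, ← hΦ] at hE
  have key' : c * ENNReal.ofReal d * N ≤ N * ENNReal.ofReal d + ENNReal.ofReal M :=
    key.trans (add_le_add hE (ENNReal.ofReal_le_ofReal (le_max_left _ _)))
  have hfin : (N : ℝ≥0∞) * ENNReal.ofReal d + ENNReal.ofReal M ≠ ⊤ :=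
    ENNReal.add_ne_top.2 ⟨ENNReal.mul_ne_top (ENNReal.natCast_ne_top N) ENNReal.ofReal_ne_top,
      ENNReal.ofReal_ne_top⟩
  by_cases hct : c = ⊤
  · rw [hct, ENNReal.top_mul ((ENNReal.ofReal_pos.2 hdpos).ne'),
      ENNReal.top_mul (Nat.cast_ne_zero.2 hN.ne')] at key'
    exact hfin (top_le_iff.1 key')
  · have hK' : K = (c.toReal - 1) * N := by rw [hK, if_neg hct]
    have hr := ENNReal.toReal_mono hfin key'
    rw [ENNReal.toReal_mul, ENNReal.toReal_mul, ENNReal.toReal_ofReal hdpos.le,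
      ENNReal.toReal_natCast, ENNReal.toReal_add (ENNReal.mul_ne_top (ENNReal.natCast_ne_top N)
        ENNReal.ofReal_ne_top) ENNReal.ofReal_ne_top, ENNReal.toReal_mul, ENNReal.toReal_natCast,
      ENNReal.toReal_ofReal hdpos.le, ENNReal.toReal_ofReal hM0] at hr
    -- hr : c.toReal * d * N ≤ N * d + M ;  hdK : M < d * ((c.toReal - 1) * N)
    rw [hK'] at hdK
    have e1 : d * ((c.toReal - 1) * N) = c.toReal * d * N - N * d := by ring
    rw [e1] at hdK
    linarith

/-- **The coefficient is load-bearing exactly at `1`, already for the free gas**: with `v ≡ 0` the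
body holds for every `c ≤ 1` (zero price) and fails for every `c > 1` (unbounded price). [folklore] -/
theorem coefficient_threshold_free_gas :
    (∀ c : ℝ≥0∞, c ≤ 1 → ∀ ρ : ℝ, 0 < ρ → ∀ C : ℝ, ∀ N : ℕ, 0 < N → ModePriceBody c 0 C ρ N) ∧
    (∀ c : ℝ≥0∞, 1 < c → ∀ ρ : ℝ, 0 < ρ → ∀ C : ℝ, ∀ N : ℕ, 0 < N → ¬ ModePriceBody c 0 C ρ N) :=
  ⟨fun _ hc _ hρ C _ hN => modePriceBody_zero_pot_of_le_one hc hρ C hN,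
    fun _ hc _ hρ C _ hN => not_modePriceBody_zero_pot_of_one_lt hc hρ C hN⟩

/-- **Refuted strengthening**: the crux with ANY softening coefficient `c > 1` in place of `½` is
false (witness `v ≡ 0`, boosted constant state, `|k| → ∞`). [folklore] -/
theorem modePriceWithCoeff_false_of_one_lt {c : ℝ≥0∞} (hc : 1 < c) : ¬ ModePriceWithCoeff c := by
  intro h
  obtain ⟨C, -, ρ₀, hρ₀, h⟩ := h 0 ⟨measurable_const, 0, fun _ _ => rfl⟩ (by simp)
  have hρ : (0 : ℝ) < ρ₀ / 2 := by positivity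
  obtain ⟨N₀, hN₀⟩ := eventually_atTop.1 (h (ρ₀ / 2) hρ (by linarith))
  exact not_modePriceBody_zero_pot_of_one_lt hc hρ C (Nat.succ_pos N₀)
    (hN₀ (N₀ + 1) (Nat.le_succ N₀))

/-- The free-gas instance of `ModePriceWithCoeff c` for `c ≤ 1` (in particular of the crux,
`c = 2⁻¹`): true with `C = 1`, `ρ₀ = 1`. [folklore] -/
theorem modePriceWithCoeff_zero_pot_of_le_one {c : ℝ≥0∞} (hc : c ≤ 1) :
    ∃ C : ℝ, 0 < C ∧ ∃ ρ₀ : ℝ, 0 < ρ₀ ∧ ∀ ρ : ℝ, 0 < ρ → ρ < ρ₀ →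
      ∀ᶠ N : ℕ in atTop, ModePriceBody c 0 C ρ N :=
  ⟨1, one_pos, 1, one_pos, fun _ hρ _ =>
    (eventually_gt_atTop 0).mono fun _ hN => modePriceBody_zero_pot_of_le_one hc hρ 1 hN⟩

/-- The crux's own conclusion at the junk model `v ≡ 0` (true for the intended reason). [folklore] -/
theorem modePriceIntegrable_zero_pot :
    ∃ C : ℝ, 0 < C ∧ ∃ ρ₀ : ℝ, 0 < ρ₀ ∧ ∀ ρ : ℝ, 0 < ρ → ρ < ρ₀ →
      ∀ᶠ N : ℕ in atTop, ModePriceBody 2⁻¹ 0 C ρ N :=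
  modePriceWithCoeff_zero_pot_of_le_one (ENNReal.inv_le_one.2 one_le_two)

/-! ## §2 Idle hypothesis and reductions -/

/-- **`p ≠ 0` is decoration**: at `p = 0` the symbol vanishes and the body reads
`E₀ ≤ ⟨Ψ,HΨ⟩ + Cρ`, true for every `v`, `c`, `C`, `N`. [folklore] -/
theorem modePriceBody_zero_mode (c : ℝ≥0∞) (v : ℝ → ℝ≥0∞) (C ρ : ℝ) (N : ℕ)
    (Ψ : PeriodicTrialState N (sideLength ρ N)) :
    periodicGroundStateEnergy v N (sideLength ρ N) +
        c * fracDispersion 2 (sideLength ρ N) 0 *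
          cellOccupation N (sideLength ρ N) (planeWaveMode (sideLength ρ N) 0) Ψ.ψ ≤
      periodicEnergy v Ψ + ENNReal.ofReal (C * ρ) := by
  rw [fracDispersion_zero two_ne_zero, mul_zero, zero_mul, add_zero]
  exact (periodicGroundStateEnergy_le v Ψ).trans le_self_add

/-- **Only the window `⟨Ψ,HΨ⟩ < 2E₀` matters**: for any `v`, `L > 0` and any state with
`⟨Ψ,HΨ⟩ ≥ 2E₀^per` the crux body holds at every mode with ZERO budget
(`E₀ + ½|k|²n_p ≤ ½⟨Ψ,HΨ⟩ + ½⟨Ψ,HΨ⟩`). [folklore] -/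
theorem modePrice_of_twice_le (hL : 0 < L) (v : ℝ → ℝ≥0∞) (Ψ : PeriodicTrialState N L)
    (hΨ : 2 * periodicGroundStateEnergy v N L ≤ periodicEnergy v Ψ) (p : Fin 3 → ℤ) :
    periodicGroundStateEnergy v N L + 2⁻¹ * fracDispersion 2 L p *
        cellOccupation N L (planeWaveMode L p) Ψ.ψ ≤ periodicEnergy v Ψ := by
  have h1 : periodicGroundStateEnergy v N L ≤ 2⁻¹ * periodicEnergy v Ψ := by
    calc periodicGroundStateEnergy v N L = 2⁻¹ * (2 * periodicGroundStateEnergy v N L) := by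
          rw [← mul_assoc, ENNReal.inv_mul_cancel (by norm_num) (by norm_num), one_mul]
      _ ≤ 2⁻¹ * periodicEnergy v Ψ := by gcongr
  have h2 : 2⁻¹ * fracDispersion 2 L p * cellOccupation N L (planeWaveMode L p) Ψ.ψ ≤
      2⁻¹ * periodicEnergy v Ψ := by
    rw [mul_assoc]
    gcongr
    exact fracDispersion_mul_cellOccupation_le hL v Ψ p
  calc _ ≤ 2⁻¹ * periodicEnergy v Ψ + 2⁻¹ * periodicEnergy v Ψ := add_le_add h1 h2
    _ = periodicEnergy v Ψ := by rw [← add_mul, ENNReal.inv_two_add_inv_two, one_mul]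

end Summit.AtomisticToContinuum.BoseEinsteinCondensation.Theorems.ModePriceIntegrable.Negative

end
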